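import Literature.NumberTheory.Transcendental.QuadraticRelationsLogarithmsSec6L62
import HarnessLib

/-!
# Roy–Waldschmidt 1997, §6 (iv) (a): Énoncé 1 for `𝒞_ε` from Théorème 5.1

D. Roy, M. Waldschmidt, Ann. Sci. ÉNS (4) 30 (1997) 753–796, §6 (iv) (a), pp. 788–789: for
`X = (d₀, d₁, W, Y, Y_a) ∈ 𝒞_ε` with `b_ε(X) ≠ 0`, Énoncé 1 of Proposition 6.1 holds.  If
`κ(X) = 0`, Théorème 5.1 applied to `W, Y, Y_a` gives an algebraic subgroup `L ≠ G` of
`G = 𝐆_a^{d₀} × 𝐆_m^{d₁}`; with `h : G → G' = G/L ≅ 𝐆_a^{d₀'} × 𝐆_m^{d₁'}` and `g` the linear map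
with `h ∘ exp_G = exp_{G'} ∘ g`, `X' = (d₀', d₁', gW, gY, gY_a) ∈ 𝒞_ε`, `s = m(g, X, X')` is a
cokernel, `λ' = ℓ₁(X') - κ(X')`, `λ_a' = ℓ_a(X') - κ_a(X')`, and (5.1) gives (6.4)
`b(X)(a(X') + c(X')) ≤ a(X)(b(X') + d(X'))`, while `L ≠ G` gives `r(X') ≠ 0` hence
`b(X') + d(X') > 0` (Lemme 6.3).  In general Lemme 6.4 first provides a cokernel `X → X'` with
`b(X') > 0`, `κ(X') = 0`, `a(X')/b(X') ≤ a(X)/b(X)`, and one composes.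

**The hypothesis `h51`** is Théorème 5.1 (p. 779) in exactly this tangent-space form: for `K`
finitely generated of transcendence degree `1`, `W ⊆ T_G(K)`, `Y` finitely generated with
`exp_G(Y) ⊆ G(K)`, `Y_a ≤ Y` with `exp_G(Y_a) ⊆ G₀(K) × G₁(K ∩ ℚ̄)` (= an object of `𝒞` over `K`)
and `d > 0`, there are `d₀', d₁'` and a surjective linear `g : ℂ^{d₀} × ℂ^{d₁} → ℂ^{d₀'} × ℂ^{d₁'}`
with `g(K^{d₀} × 0) ⊆ K^{d₀'} × 0`, `g(0 × ℚ^{d₁}) ⊆ 0 × ℚ^{d₁'}`, `g(0 × ℤ^{d₁}) ⊆ 0 × ℤ^{d₁'}`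
(the tangent map of the quotient `G → G/L` by a connected algebraic subgroup `L ≠ G` defined over
`K`: `L ↔ T_L = T₀ × T₁ = ker g`, `T₀` defined over `K`, `T₁` over `ℚ`), `d' = d₀' + d₁' > 0`, such
that for every real `0 < ε ≤ (2d(d + λ) + 1)⁻¹`, `λ = rang Γ = ℓ₁ - κ`,
`((d - 2n) + ε(n - d₀))(d₁' + λ') ≤ d₁((d' - ℓ₀') + ε(ℓ₀' - d₀') - ε²λ_a')` (5.1) with
`ℓ₀' = dim_K gW`, `λ' = rang gY - rang(gY ∩ (0 × ωℤ^{d₁'}))`,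
`λ_a' = rang gY_a - rang(gY_a ∩ (0 × ωℤ^{d₁'}))` ("avec les notations du théorème 5.1, on a
`λ' = ℓ₁(X') - κ(X')` et `λ_a' = ℓ_a(X') - κ_a(X')`", p. 789).

* `Ceps.enonce1_of_thm_5_1` — **Énoncé 1 holds in `𝒞_ε`** under `h51` (pp. 788–789).

No named facts.

## References

* [RoyWaldschmidt1997ENS] D. Roy, M. Waldschmidt, Ann. Sci. ÉNS (4) 30 (1997) 753–796:
  Théorème 5.1 p. 779; §6 (iv) (a) pp. 788–789 (read on the rendered scan).
-/

noncomputable section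

open Complex IntermediateField Module Submodule

namespace Literature.NumberTheory.Transcendental

namespace RoyWaldschmidt1997

open LiePresentation

variable {K : IntermediateField ℚ ℂ} {N : ℕ}

/-! ### Integral linear maps -/

/-- A linear map sending integer vectors to integer vectors is given by an integer matrix. [folklore] -/
theorem exists_intMatrix {a b : ℕ} (g₁ : (Fin a → ℂ) →ₗ[ℂ] (Fin b → ℂ))
    (hint : ∀ z : Fin a → ℤ, ∃ z' : Fin b → ℤ, g₁ (fun j => (z j : ℂ)) = fun i => (z' i : ℂ)) :
    ∃ Z : Matrix (Fin b) (Fin a) ℤ, ∀ v i, g₁ v i = ∑ j, (Z i j : ℂ) * v j := by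
  classical
  choose zc hzc using fun j : Fin a => hint (Pi.single j 1)
  refine ⟨fun i j => zc j i, fun v i => ?_⟩
  have hv : v = ∑ j, v j • fun k => (((Pi.single j (1 : ℤ) : Fin a → ℤ) k : ℤ) : ℂ) := by
    funext k
    simp [Finset.sum_apply, Pi.single_apply, Int.cast_ite]
  conv_lhs => rw [hv, map_sum]
  simp only [map_smul, Finset.sum_apply, Pi.smul_apply, smul_eq_mul]
  refine Finset.sum_congr rfl fun j _ => ?_
  rw [hzc j, mul_comm]

/-! ### The quotient object attached to the map of Théorème 5.1 -/

namespace RWObj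

set_option maxHeartbeats 800000 in
/-- **The quotient object `X' = (d₀', d₁', gW, gY, gY_a)`** attached to a surjective structure map
`g` integral on `0 × ℤ^{d₁}` (the tangent map of `G → G/L`), and `m(g, X, X')` a cokernel (p. 789).
[cite: RoyWaldschmidt1997ENS, §6 (iv) (a), pp. 788–789] -/
theorem exists_quotObj (X : RWObj K) {d₀' d₁' : ℕ}
    (g : ((Fin X.d₀ → ℂ) × (Fin X.d₁ → ℂ)) →ₗ[ℂ] ((Fin d₀' → ℂ) × (Fin d₁' → ℂ)))
    (hstruct : IsStruct K g) (hsurj : Function.Surjective g)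
    (hint : ∀ z : Fin X.d₁ → ℤ, ∃ z' : Fin d₁' → ℤ, g (0, fun j => (z j : ℂ)) = (0, fun j => (z' j : ℂ))) :
    ∃ X' : RWObj K, ∃ (hd₀ : X'.d₀ = d₀') (hd₁ : X'.d₁ = d₁'),
      IsCoker X X' (hd₀ ▸ hd₁ ▸ g) ∧
      X'.ell₀ = Module.finrank K ↥(X.W.map (g.restrictScalars K)) ∧
      X'.ell₁ = Module.finrank ℤ ↥(X.Y.map (g.restrictScalars ℤ)) ∧
      X'.ellA = Module.finrank ℤ ↥(X.Ya.map (g.restrictScalars ℤ)) ∧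
      X'.kap = Module.finrank ℤ ↥(X.Y.map (g.restrictScalars ℤ) ⊓ omegaLattice d₀' d₁') ∧
      X'.kapA = Module.finrank ℤ ↥(X.Ya.map (g.restrictScalars ℤ) ⊓ omegaLattice d₀' d₁') := by
  classical
  obtain ⟨g₀, g₁, g₀K, g₁₀, hgap, hg₀K, hg₁₀⟩ := hstruct.exists_block
  have hint₁ : ∀ z : Fin X.d₁ → ℤ, ∃ z' : Fin d₁' → ℤ, g₁ (fun j => (z j : ℂ)) = fun i => (z' i : ℂ) := by
    intro z
    obtain ⟨z', hz'⟩ := hint z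
    refine ⟨z', ?_⟩
    have := congrArg Prod.snd hz'
    rw [hgap] at this
    exact this
  obtain ⟨Z, hZ⟩ := exists_intMatrix g₁ hint₁
  have hco1 : ∀ u : Fin X.d₀ → ℂ, (∀ i, u i ∈ K) → ∀ i, g₀ u i ∈ K := by
    intro u hu i
    obtain ⟨c, rfl⟩ := exists_ofK_of_mem K hu
    rw [hg₀K]; simp [ofK_apply]
  set W' : Submodule K ((Fin d₀' → ℂ) × (Fin d₁' → ℂ)) := X.W.map (g.restrictScalars K) with hW'
  set Y' : Submodule ℤ ((Fin d₀' → ℂ) × (Fin d₁' → ℂ)) := X.Y.map (g.restrictScalars ℤ) with hY'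
  set Ya' : Submodule ℤ ((Fin d₀' → ℂ) × (Fin d₁' → ℂ)) := X.Ya.map (g.restrictScalars ℤ) with hYa'
  have hW'K : ∀ w ∈ W', (∀ i, w.1 i ∈ K) ∧ (∀ j, w.2 j ∈ K) := by
    rintro _ ⟨w, hw, rfl⟩
    obtain ⟨h1, h2⟩ := X.hW w hw
    refine ⟨fun i => ?_, fun l => ?_⟩
    · show (g w).1 i ∈ K
      rw [hgap]; exact hco1 w.1 h1 i
    · show (g w).2 l ∈ K
      rw [hgap]; simp only
      rw [hZ]
      exact Subalgebra.sum_mem _ fun j _ => mul_mem (intCast_mem _ _) (h2 j)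
  have hY'fg : Y'.FG := X.hYfg.map _
  have hY'K : ∀ y ∈ Y', (∀ i, y.1 i ∈ K) ∧ (∀ j, cexp (y.2 j) ∈ K) := by
    rintro _ ⟨y, hy, rfl⟩
    obtain ⟨h1, h2⟩ := X.hY y hy
    refine ⟨fun i => ?_, fun l => ?_⟩
    · show (g y).1 i ∈ K
      rw [hgap]; exact hco1 y.1 h1 i
    · show cexp ((g y).2 l) ∈ K
      rw [hgap]; simp only
      rw [hZ]
      exact cexp_sum_int_mul_mem K _ h2
  have hYa'le : Ya' ≤ Y' := Submodule.map_mono X.hYa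
  have hYa'L : ∀ y ∈ Ya', ∀ j, IsAlgebraic ℚ (cexp (y.2 j)) := by
    rintro _ ⟨y, hy, rfl⟩ l
    show IsAlgebraic ℚ (cexp ((g y).2 l))
    rw [hgap]; simp only
    rw [hZ]
    exact isAlgebraic_cexp_sum_int_mul _ (X.hYaL y hy)
  let X' : RWObj K := ⟨d₀', d₁', W', hW'K, Y', hY'fg, hY'K, Ya', hYa'le, hYa'L⟩
  have hcoker : IsCoker X X' g := ⟨⟨hstruct, le_rfl, le_rfl, le_rfl⟩, hsurj, rfl, rfl, rfl⟩
  exact ⟨X', rfl, rfl, hcoker, rfl, rfl, rfl, rfl, rfl⟩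

end RWObj

/-! ### The arithmetic of (6.4) -/

/-- From (5.1) at `ε = 1/N` to (6.4) in integer form (p. 789): with `B = (N²-N)d₀ + N²d₁ - (2N²-N)n`
(`= N²b_ε(X)` when `κ(X) = 0`) and `R = (N²-N)d₀' + N²d₁' + κ_a' - (N²-N)ℓ₀' - ℓ_a'`
(`≤ N²(b_ε(X') + d_ε(X'))`), (5.1) multiplied by `N⁴` reads `B·N²(d₁' + ℓ₁' - κ') ≤ N²d₁·R`.
[cite: RoyWaldschmidt1997ENS, §6 (iv) (a), (6.4), p. 789] -/
theorem ineq_6_4_int {N d₀ d₁ n d₀' d₁' ℓ₀' ℓ₁' ℓa' κ' κa' : ℕ} (hN : 1 ≤ N)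
    (hineq : (((d₀ : ℝ) + d₁ - 2 * n) + (1 / (N : ℝ)) * ((n : ℝ) - d₀)) * ((d₁' : ℝ) + ((ℓ₁' : ℝ) - κ')) ≤
      (d₁ : ℝ) * ((((d₀' : ℝ) + d₁') - ℓ₀') + (1 / (N : ℝ)) * ((ℓ₀' : ℝ) - d₀') - (1 / (N : ℝ)) ^ 2 * ((ℓa' : ℝ) - κa'))) :
    (((N ^ 2 - N : ℕ) : ℤ) * d₀ + ((N ^ 2 : ℕ) : ℤ) * d₁ - ((2 * N ^ 2 - N : ℕ) : ℤ) * n) * (((N ^ 2 : ℕ) : ℤ) * (d₁' + ℓ₁' - κ')) ≤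
      (((N ^ 2 : ℕ) : ℤ) * d₁) * (((N ^ 2 - N : ℕ) : ℤ) * d₀' + ((N ^ 2 : ℕ) : ℤ) * d₁' + κa' - ((N ^ 2 - N : ℕ) : ℤ) * ℓ₀' - ℓa') := by
  have hNr : (0 : ℝ) < N := by exact_mod_cast hN
  have hNN : N ≤ N ^ 2 := by nlinarith
  have hNN2 : N ≤ 2 * N ^ 2 := by nlinarith
  have c1 : ((N ^ 2 - N : ℕ) : ℝ) = (N : ℝ) ^ 2 - N := by rw [Nat.cast_sub hNN]; push_cast; ring
  have c2 : ((2 * N ^ 2 - N : ℕ) : ℝ) = 2 * (N : ℝ) ^ 2 - N := by rw [Nat.cast_sub hNN2]; push_cast; ring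
  have h4 : (0 : ℝ) ≤ (N : ℝ) ^ 4 := by positivity
  have h2 := mul_le_mul_of_nonneg_left hineq h4
  have eL : (N : ℝ) ^ 4 * ((((d₀ : ℝ) + d₁ - 2 * n) + (1 / (N : ℝ)) * ((n : ℝ) - d₀)) * ((d₁' : ℝ) + ((ℓ₁' : ℝ) - κ'))) =
      (((((N ^ 2 - N : ℕ) : ℤ) * d₀ + ((N ^ 2 : ℕ) : ℤ) * d₁ - ((2 * N ^ 2 - N : ℕ) : ℤ) * n) * (((N ^ 2 : ℕ) : ℤ) * (d₁' + ℓ₁' - κ')) : ℤ) : ℝ) := by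
    push_cast
    rw [c1, c2]
    field_simp
    ring
  have eR : (N : ℝ) ^ 4 * ((d₁ : ℝ) * ((((d₀' : ℝ) + d₁') - ℓ₀') + (1 / (N : ℝ)) * ((ℓ₀' : ℝ) - d₀') - (1 / (N : ℝ)) ^ 2 * ((ℓa' : ℝ) - κa'))) =
      ((((((N ^ 2 : ℕ) : ℤ) * d₁) * (((N ^ 2 - N : ℕ) : ℤ) * d₀' + ((N ^ 2 : ℕ) : ℤ) * d₁' + κa' - ((N ^ 2 - N : ℕ) : ℤ) * ℓ₀' - ℓa')) : ℤ) : ℝ) := by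
    push_cast
    rw [c1]
    field_simp
    ring
  rw [eL, eR] at h2
  exact_mod_cast h2

/-! ### Énoncé 1 from Théorème 5.1 -/

namespace Ceps

set_option maxHeartbeats 1600000 in
/-- **The case `κ(X) = 0` of §6 (iv) (a)** (pp. 788–789): for `X ∈ 𝒞_ε` with `b_ε(X) ≠ 0` and
`κ(X) = 0`, Théorème 5.1 (hypothesis `h51`, in the tangent-space form described in the module
docstring) yields a cokernel `X → X'` in `𝒞_ε` with `b(X') + d(X') ≠ 0` and (6.4).
[cite: RoyWaldschmidt1997ENS, §6 (iv) (a), pp. 788–789] -/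
theorem enonce1_of_thm_5_1_kap_zero
    (h51 : ∀ X : RWObj K, 0 < X.d₀ + X.d₁ →
      ∃ (d₀' d₁' : ℕ) (g : ((Fin X.d₀ → ℂ) × (Fin X.d₁ → ℂ)) →ₗ[ℂ] ((Fin d₀' → ℂ) × (Fin d₁' → ℂ))),
        IsStruct K g ∧ Function.Surjective g ∧
        (∀ z : Fin X.d₁ → ℤ, ∃ z' : Fin d₁' → ℤ, g (0, fun j => (z j : ℂ)) = (0, fun j => (z' j : ℂ))) ∧
        0 < d₀' + d₁' ∧
        ∀ ε : ℝ, 0 < ε → ε ≤ 1 / (2 * ((X.d₀ : ℝ) + X.d₁) * (((X.d₀ : ℝ) + X.d₁) + ((X.ell₁ : ℝ) - X.kap)) + 1) →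
          ((((X.d₀ : ℝ) + X.d₁) - 2 * X.nn) + ε * ((X.nn : ℝ) - X.d₀)) *
              ((d₁' : ℝ) + ((Module.finrank ℤ ↥(X.Y.map (g.restrictScalars ℤ)) : ℝ) -
                Module.finrank ℤ ↥(X.Y.map (g.restrictScalars ℤ) ⊓ omegaLattice d₀' d₁'))) ≤
            (X.d₁ : ℝ) * ((((d₀' : ℝ) + d₁') - Module.finrank K ↥(X.W.map (g.restrictScalars K))) +
              ε * ((Module.finrank K ↥(X.W.map (g.restrictScalars K)) : ℝ) - d₀') -
              ε ^ 2 * ((Module.finrank ℤ ↥(X.Ya.map (g.restrictScalars ℤ)) : ℝ) -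
                Module.finrank ℤ ↥(X.Ya.map (g.restrictScalars ℤ) ⊓ omegaLattice d₀' d₁'))))
    (X : Ceps K N) (hbX : X.1.bE N ≠ 0) (hkap : X.1.kap = 0) :
    ∃ X' : Ceps K N, Quot X X' ∧ X'.1.bE N + X'.1.dE N ≠ 0 ∧
      (X'.1.aE N + X'.1.cE N) * X.1.bE N ≤ X.1.aE N * (X'.1.bE N + X'.1.dE N) := by
  have hN := one_le_N X
  have hkapA : X.1.kapA = 0 := by have := X.1.kapA_le_kap; omega
  -- `d > 0` (otherwise `b = 0`)
  have hd : 0 < X.1.d₀ + X.1.d₁ := by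
    by_contra h0
    push Not at h0
    have h1 : X.1.d₀ = 0 := by omega
    have h2 : X.1.d₁ = 0 := by omega
    apply hbX
    simp only [RWObj.bE, RWObj.dd₀, RWObj.dd₁, h1, h2, hkapA, mul_zero, add_zero, Nat.zero_sub]
  obtain ⟨d₀', d₁', g, hstruct, hsurj, hint, hd'pos, hineq⟩ := h51 X.1 hd
  obtain ⟨X', hX'd₀, hX'd₁, hcoker, hℓ₀, hℓ₁, hℓa, hκ, hκa⟩ := X.1.exists_quotObj g hstruct hsurj hint
  -- `X' ∈ 𝒞_ε`
  obtain ⟨Xs, hex⟩ := hcoker.exists_exact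
  have hmem' : 2 * X'.dd * (X'.dd + X'.ell₁) + 1 ≤ N := mem_of_exact_right hex X.2
  let X'' : Ceps K N := ⟨X', hmem'⟩
  have hQ : Quot X X'' := ⟨_, hcoker⟩
  -- the instance of (5.1) at `ε = 1/N`
  have hεpos : (0 : ℝ) < 1 / (N : ℝ) := by positivity
  have hεle : (1 : ℝ) / N ≤ 1 / (2 * ((X.1.d₀ : ℝ) + X.1.d₁) * (((X.1.d₀ : ℝ) + X.1.d₁) + ((X.1.ell₁ : ℝ) - X.1.kap)) + 1) := by
    have hmem := X.2
    simp only [RWObj.dd] at hmem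
    have hk : X.1.kap ≤ X.1.ell₁ := X.1.kap_le_ell₁
    rw [div_le_div_iff₀ (by positivity) (by
      have : (0 : ℝ) ≤ 2 * ((X.1.d₀ : ℝ) + X.1.d₁) * (((X.1.d₀ : ℝ) + X.1.d₁) + ((X.1.ell₁ : ℝ) - X.1.kap)) := by
        have : (0 : ℝ) ≤ (X.1.ell₁ : ℝ) - X.1.kap := by
          have : (X.1.kap : ℝ) ≤ X.1.ell₁ := by exact_mod_cast hk
          linarith
        positivity
      linarith), one_mul, one_mul]
    have h1 : (2 * (X.1.d₀ + X.1.d₁) * (X.1.d₀ + X.1.d₁ + X.1.ell₁) + 1 : ℝ) ≤ N := by exact_mod_cast hmem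
    have h2 : 2 * ((X.1.d₀ : ℝ) + X.1.d₁) * (((X.1.d₀ : ℝ) + X.1.d₁) + ((X.1.ell₁ : ℝ) - X.1.kap)) ≤
        2 * ((X.1.d₀ : ℝ) + X.1.d₁) * ((X.1.d₀ : ℝ) + X.1.d₁ + X.1.ell₁) := by
      have : (0 : ℝ) ≤ X.1.kap := Nat.cast_nonneg _
      have : (0 : ℝ) ≤ (X.1.d₀ : ℝ) + X.1.d₁ := by positivity
      nlinarith
    linarith
  have h51ε := hineq (1 / (N : ℝ)) hεpos hεle
  rw [← hℓ₀, ← hℓ₁, ← hℓa, ← hκ, ← hκa] at h51ε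
  -- to integers
  have hZ := ineq_6_4_int hN h51ε
  refine ⟨X'', hQ, ?_, ?_⟩
  · -- `b(X') + d(X') ≠ 0` since `r(X') = N² d' ≠ 0` (Lemme 6.3)
    intro h0
    have := rE_eq_zero_of_bE_add_dE X'' h0
    simp only [RWObj.rE, RWObj.dd] at this
    rcases Nat.mul_eq_zero.mp this with h1 | h1
    · exact absurd h1 (by positivity)
    · change X'.d₀ + X'.d₁ = 0 at h1
      rw [hX'd₀, hX'd₁] at h1
      omega
  · -- (6.4)
    have hdE := dE_exact X''
    have hk' : X'.kap ≤ d₁' := by have := X'.kap_le_dd₁; simpa [RWObj.dd₁, hX'd₁] using this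
    have hNN : N ≤ N ^ 2 := by nlinarith
    -- untruncated `b(X)`
    have hbpos : (2 * N ^ 2 - N) * X.1.nn < (N ^ 2 - N) * X.1.d₀ + N ^ 2 * X.1.d₁ := by
      have : X.1.bE N ≠ 0 := hbX
      simp only [RWObj.bE, RWObj.dd₀, RWObj.dd₁, hkapA, add_zero] at this
      omega
    show (X'.aE N + X'.cE N) * X.1.bE N ≤ X.1.aE N * (X'.bE N + X'.dE N)
    simp only [RWObj.aE, RWObj.bE, RWObj.cE, RWObj.dE, RWObj.dd₀, RWObj.dd₁, hkapA, hkap, add_zero, Nat.sub_zero]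
    rw [show X'.d₀ = d₀' from hX'd₀, show X'.d₁ = d₁' from hX'd₁]
    change (N ^ 2 - N) * X'.ell₀ + X'.ellA ≤ (2 * N ^ 2 - N) * X'.nn at hdE
    zify [hk', hbpos.le, hdE]
    have hsub : ((((N ^ 2 - N) * d₀' + N ^ 2 * d₁' + X'.kapA : ℕ)) : ℤ) - (((2 * N ^ 2 - N) * X'.nn : ℕ) : ℤ) ≤
        ((((N ^ 2 - N) * d₀' + N ^ 2 * d₁' + X'.kapA - (2 * N ^ 2 - N) * X'.nn : ℕ)) : ℤ) := by omega
    push_cast at hsub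
    have hmul := mul_le_mul_of_nonneg_left hsub (show (0 : ℤ) ≤ ((N ^ 2 : ℕ) : ℤ) * X.1.d₁ by positivity)
    push_cast at hZ hmul ⊢
    nlinarith [hZ, hmul]

/-- **Énoncé 1 of Proposition 6.1 holds in `𝒞_ε`** (Roy–Waldschmidt 1997, §6 (iv) (a),
pp. 788–789), given Théorème 5.1 in the tangent-space form `h51` (see the module docstring): for
`X ∈ 𝒞_ε` with `b_ε(X) ≠ 0` there is a cokernel `X → X'` in `𝒞_ε` with `b(X') + d(X') ≠ 0` and
`(a(X') + c(X'))·b(X) ≤ a(X)·(b(X') + d(X'))`.  General case: a minimiser `X → X₁` of `a/b` with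
`r` minimal exists (finitely many ratio values) and has `κ(X₁) = 0` by Lemme 6.4; apply the case
`κ = 0` to `X₁` and compose. [cite: RoyWaldschmidt1997ENS, §6 (iv) (a), pp. 788–789] -/
theorem enonce1_of_thm_5_1
    (h51 : ∀ X : RWObj K, 0 < X.d₀ + X.d₁ →
      ∃ (d₀' d₁' : ℕ) (g : ((Fin X.d₀ → ℂ) × (Fin X.d₁ → ℂ)) →ₗ[ℂ] ((Fin d₀' → ℂ) × (Fin d₁' → ℂ))),
        IsStruct K g ∧ Function.Surjective g ∧
        (∀ z : Fin X.d₁ → ℤ, ∃ z' : Fin d₁' → ℤ, g (0, fun j => (z j : ℂ)) = (0, fun j => (z' j : ℂ))) ∧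
        0 < d₀' + d₁' ∧
        ∀ ε : ℝ, 0 < ε → ε ≤ 1 / (2 * ((X.d₀ : ℝ) + X.d₁) * (((X.d₀ : ℝ) + X.d₁) + ((X.ell₁ : ℝ) - X.kap)) + 1) →
          ((((X.d₀ : ℝ) + X.d₁) - 2 * X.nn) + ε * ((X.nn : ℝ) - X.d₀)) *
              ((d₁' : ℝ) + ((Module.finrank ℤ ↥(X.Y.map (g.restrictScalars ℤ)) : ℝ) -
                Module.finrank ℤ ↥(X.Y.map (g.restrictScalars ℤ) ⊓ omegaLattice d₀' d₁'))) ≤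
            (X.d₁ : ℝ) * ((((d₀' : ℝ) + d₁') - Module.finrank K ↥(X.W.map (g.restrictScalars K))) +
              ε * ((Module.finrank K ↥(X.W.map (g.restrictScalars K)) : ℝ) - d₀') -
              ε ^ 2 * ((Module.finrank ℤ ↥(X.Ya.map (g.restrictScalars ℤ)) : ℝ) -
                Module.finrank ℤ ↥(X.Ya.map (g.restrictScalars ℤ) ⊓ omegaLattice d₀' d₁'))))
    (X : Ceps K N) (hbX : X.1.bE N ≠ 0) :
    ∃ X' : Ceps K N, Quot X X' ∧ X'.1.bE N + X'.1.dE N ≠ 0 ∧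
      (X'.1.aE N + X'.1.cE N) * X.1.bE N ≤ X.1.aE N * (X'.1.bE N + X'.1.dE N) := by
  have hN := one_le_N X
  -- bounds for the minimisation over the quotients of `X`
  have hbounds : ∀ X' : Ceps K N, Quot X X' → X'.1.aE N ≤ N ^ 2 * X.1.dd ∧ X'.1.bE N ≤ N ^ 2 * X.1.dd := by
    intro X' hQ
    obtain ⟨Xs, hex⟩ := RoyWaldschmidt1997.quot_exists_exact (X := X.1) (X' := X'.1) hQ
    have hd := hex.dd_add
    have hd' : X'.1.dd ≤ X.1.dd := by omega
    refine ⟨?_, ?_⟩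
    · simp only [RWObj.aE]
      refine Nat.mul_le_mul_left _ ?_
      have : X'.1.dd₁ ≤ X'.1.dd := Nat.le_add_left _ _
      omega
    · refine (bE_le_rE X').trans ?_
      simp only [RWObj.rE]
      exact Nat.mul_le_mul_left _ hd'
  obtain ⟨X₁, ⟨hQ₁, hb₁⟩, hmin₁, hrmin₁⟩ := RoyCategory.exists_min_ratio_min (Ob := Ceps K N)
    (fun X' => Quot X X' ∧ X'.1.bE N ≠ 0) (fun X' => X'.1.aE N) (fun X' => X'.1.bE N) (fun X' => X'.1.rE N)
    (X₀ := X) ⟨quot_refl X, hbX⟩ (fun X' h => (hbounds X' h.1).1) (fun X' h => (hbounds X' h.1).2)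
    (fun X' h => Nat.pos_of_ne_zero h.2)
  have hk₁ : X₁.1.kap = 0 := lemme_6_4 X X₁ hQ₁ hb₁ hmin₁ hrmin₁
  obtain ⟨X₂, hQ₂, hbd₂, hineq₂⟩ := enonce1_of_thm_5_1_kap_zero h51 X₁ hb₁ hk₁
  refine ⟨X₂, quot_trans X X₁ X₂ hQ₁ hQ₂, hbd₂, ?_⟩
  have h4 : X₁.1.aE N * X.1.bE N ≤ X.1.aE N * X₁.1.bE N := hmin₁ X ⟨quot_refl X, hbX⟩
  have key : (X₂.1.aE N + X₂.1.cE N) * X.1.bE N * X₁.1.bE N ≤ X.1.aE N * (X₂.1.bE N + X₂.1.dE N) * X₁.1.bE N := by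
    calc (X₂.1.aE N + X₂.1.cE N) * X.1.bE N * X₁.1.bE N
        = ((X₂.1.aE N + X₂.1.cE N) * X₁.1.bE N) * X.1.bE N := by ring
      _ ≤ (X₁.1.aE N * (X₂.1.bE N + X₂.1.dE N)) * X.1.bE N := Nat.mul_le_mul_right _ hineq₂
      _ = (X₁.1.aE N * X.1.bE N) * (X₂.1.bE N + X₂.1.dE N) := by ring
      _ ≤ (X.1.aE N * X₁.1.bE N) * (X₂.1.bE N + X₂.1.dE N) := Nat.mul_le_mul_right _ h4
      _ = X.1.aE N * (X₂.1.bE N + X₂.1.dE N) * X₁.1.bE N := by ring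
  exact Nat.le_of_mul_le_mul_right key (Nat.pos_of_ne_zero hb₁)

end Ceps

end RoyWaldschmidt1997

end Literature.NumberTheory.Transcendental
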